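import Literature.MathematicalPhysics.QuantumLattice.HubbardWindowCertificate
import Literature.MathematicalPhysics.QuantumLattice.MagneticHubbardTorusGauge
import HarnessLib

/-!
# Flux-torus ceiling II — symmetries of the uniformly twisted torus

HONEST FRAMING: first certified bounds; not a superconductivity verdict; every number certified or
labelled float. Part 2 of the kernel transport of window certificates to the flux sectors of the
Hubbard torus (`Rows/TorusCeilingFlux.lean`): translation invariance and sector preservation of
`H_u = magneticHubbardTorus L (uniformTwistConfig L θ) t U` (the uniform gauge of the flux torus,
Lieb 1994); the averaging engine itself is the tree's
`torus_minEnergyOn_div_ge_of_local_certificate` (`HubbardNNNHoppingWindowCertificate.lean`).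
[cite: Lieb1994, eq. (1)] [cite: Han2020Bootstrap, §3]
-/

noncomputable section

open Matrix Finset
open Literature.MathematicalPhysics.QuantumLattice
open Literature.MathematicalPhysics.QuantumFieldTheory hiding Site
open Literature.MathematicalPhysics.QuantumManyBody.StateRelaxation
open Literature.Probability.LatticeModels
open HubbardWave0
open scoped ComplexOrder ComplexConjugate

namespace Summit.Ventures.CertifiedManyBodySolver.Rows

/-! ### §2. Symmetries of the uniformly twisted torus -/

section Torus

variable {d L : ℕ} [NeZero L]

/-- Elaborate torus identities with the order-derived `DecidableEq` (as the tree's torus files do). -/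
local instance (priority := high) instDecidableEqFermionTorusFlux : DecidableEq (FermionTorus d L) :=
  LinearOrder.toDecidableEq

/-- **Translation invariance of a magnetic Hubbard torus with a translation-invariant field**
(in particular the uniform twist `uniformTwistConfig`): `T_v H_A T_v⁻¹ = H_A`.
[cite: Lieb1994, eq. (1)] -/
theorem relabel_translate_magneticHubbardTorus (v : TorusSite 2 L) (A : GaugeConfig 2 L Circle)
    (hA : ∀ x i, A (x + v, i) = A (x, i)) (t U : ℝ) :
    relabel (Orb.translate v) (magneticHubbardTorus L A t U) = magneticHubbardTorus L A t U := by
  have hshift : ∀ (x : TorusSite 2 L) (i : Fin 2),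
      Literature.MathematicalPhysics.QuantumFieldTheory.Site.shift x i + v =
        Literature.MathematicalPhysics.QuantumFieldTheory.Site.shift (x + v) i := by
    intro x i
    simp only [Literature.MathematicalPhysics.QuantumFieldTheory.Site.shift]
    abel
  have hhop : relabel (Orb.translate v) (∑ x : TorusSite 2 L, ∑ i : Fin 2, ∑ σ : Fin 2,
        (((A (x, i) : Circle) : ℂ) •
            (creation (orb (FermionTorus.ofTorusSite
                (Literature.MathematicalPhysics.QuantumFieldTheory.Site.shift x i)) σ) *
              annihilation (orb (FermionTorus.ofTorusSite x) σ)) +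
          (starRingEnd ℂ) ((A (x, i) : Circle) : ℂ) •
            (creation (orb (FermionTorus.ofTorusSite x) σ) *
              annihilation (orb (FermionTorus.ofTorusSite
                (Literature.MathematicalPhysics.QuantumFieldTheory.Site.shift x i)) σ)))) =
      ∑ x : TorusSite 2 L, ∑ i : Fin 2, ∑ σ : Fin 2,
        (((A (x, i) : Circle) : ℂ) •
            (creation (orb (FermionTorus.ofTorusSite
                (Literature.MathematicalPhysics.QuantumFieldTheory.Site.shift x i)) σ) *
              annihilation (orb (FermionTorus.ofTorusSite x) σ)) +
          (starRingEnd ℂ) ((A (x, i) : Circle) : ℂ) •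
            (creation (orb (FermionTorus.ofTorusSite x) σ) *
              annihilation (orb (FermionTorus.ofTorusSite
                (Literature.MathematicalPhysics.QuantumFieldTheory.Site.shift x i)) σ))) := by
    rw [map_sum]
    have step : ∀ x : TorusSite 2 L, relabel (Orb.translate v) (∑ i : Fin 2, ∑ σ : Fin 2,
        (((A (x, i) : Circle) : ℂ) •
            (creation (orb (FermionTorus.ofTorusSite
                (Literature.MathematicalPhysics.QuantumFieldTheory.Site.shift x i)) σ) *
              annihilation (orb (FermionTorus.ofTorusSite x) σ)) +
          (starRingEnd ℂ) ((A (x, i) : Circle) : ℂ) •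
            (creation (orb (FermionTorus.ofTorusSite x) σ) *
              annihilation (orb (FermionTorus.ofTorusSite
                (Literature.MathematicalPhysics.QuantumFieldTheory.Site.shift x i)) σ)))) =
        ∑ i : Fin 2, ∑ σ : Fin 2,
        (((A (x + v, i) : Circle) : ℂ) •
            (creation (orb (FermionTorus.ofTorusSite
                (Literature.MathematicalPhysics.QuantumFieldTheory.Site.shift (x + v) i)) σ) *
              annihilation (orb (FermionTorus.ofTorusSite (x + v)) σ)) +
          (starRingEnd ℂ) ((A (x + v, i) : Circle) : ℂ) •
            (creation (orb (FermionTorus.ofTorusSite (x + v)) σ) *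
              annihilation (orb (FermionTorus.ofTorusSite
                (Literature.MathematicalPhysics.QuantumFieldTheory.Site.shift (x + v) i)) σ))) := by
      intro x
      rw [map_sum]
      refine Finset.sum_congr rfl fun i _ => ?_
      rw [map_sum]
      refine Finset.sum_congr rfl fun σ _ => ?_
      rw [map_add, map_smul, map_smul, map_mul, map_mul, relabel_translate_creation,
        relabel_translate_annihilation, relabel_translate_creation, relabel_translate_annihilation,
        hshift, hA]
    simp only [step]
    exact Equiv.sum_comp (Equiv.addRight v) (fun x : TorusSite 2 L => ∑ i : Fin 2, ∑ σ : Fin 2,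
        (((A (x, i) : Circle) : ℂ) •
            (creation (orb (FermionTorus.ofTorusSite
                (Literature.MathematicalPhysics.QuantumFieldTheory.Site.shift x i)) σ) *
              annihilation (orb (FermionTorus.ofTorusSite x) σ)) +
          (starRingEnd ℂ) ((A (x, i) : Circle) : ℂ) •
            (creation (orb (FermionTorus.ofTorusSite x) σ) *
              annihilation (orb (FermionTorus.ofTorusSite
                (Literature.MathematicalPhysics.QuantumFieldTheory.Site.shift x i)) σ))))
  have hnn : relabel (Orb.translate v) (∑ y : FermionTorus 2 L, numberOp y 0 * numberOp y 1) =
      ∑ y : FermionTorus 2 L, numberOp y 0 * numberOp y 1 := by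
    rw [map_sum]
    have step : ∀ y : FermionTorus 2 L, relabel (Orb.translate v) (numberOp y 0 * numberOp y 1) =
        numberOp (FermionTorus.ofTorusEquiv (Equiv.addRight v) y) 0 *
          numberOp (FermionTorus.ofTorusEquiv (Equiv.addRight v) y) 1 := by
      intro y
      rw [map_mul, Orb.translate, relabel_mapEquiv_numberOp, relabel_mapEquiv_numberOp]
    simp only [step]
    exact Equiv.sum_comp (FermionTorus.ofTorusEquiv (Equiv.addRight v))
      (fun y : FermionTorus 2 L => numberOp y 0 * numberOp y 1)
  rw [magneticHubbardTorus_eq, map_add, map_smul, map_smul, hhop, hnn]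

/-- Translation invariance of the uniformly twisted torus `H_u`. [cite: Lieb1994, eq. (1)] -/
theorem relabel_translate_magneticHubbardTorus_uniformTwistConfig (v : TorusSite 2 L) (θ t U : ℝ) :
    relabel (Orb.translate v) (magneticHubbardTorus L (uniformTwistConfig L θ) t U) =
      magneticHubbardTorus L (uniformTwistConfig L θ) t U :=
  relabel_translate_magneticHubbardTorus v _ (fun _ _ => rfl) t U

/-- `[T_v, H_u] = 0`. -/
theorem fockTranslate_mul_magneticHubbardTorus_uniformTwistConfig (v : TorusSite 2 L) (θ t U : ℝ) :
    (fockTranslate v).val * magneticHubbardTorus L (uniformTwistConfig L θ) t U =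
      magneticHubbardTorus L (uniformTwistConfig L θ) t U * (fockTranslate v).val :=
  (fockRelabel_commute_of_relabel_eq _
    (relabel_translate_magneticHubbardTorus_uniformTwistConfig v θ t U)).eq

/-- A magnetic Hubbard torus preserves the joint `(N, S^z)` sectors. -/
theorem mulVec_magneticHubbardTorus_mem_szSector (A : GaugeConfig 2 L Circle) (t U : ℝ) {N : ℕ}
    {M : ℝ} {ψ : Fock (Orb (FermionTorus 2 L))} (hψ : ψ ∈ szSector N M) :
    magneticHubbardTorus L A t U *ᵥ ψ ∈ szSector N M :=
  mulVec_mem_szSector_of_commute (magneticHubbardTorus_commute_totalNumber A t U)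
    (magneticHubbardTorus_commute_spinZ A t U) hψ

/-- A CONSTANT gauge transformation (a power of `e^{iN̂}`) commutes with every magnetic torus. -/
theorem phaseGauge_const_mul_magneticHubbardTorus (c : Circle) (A : GaugeConfig 2 L Circle) (t U : ℝ) :
    phaseGauge (fun _ : FermionTorus 2 L => c) * magneticHubbardTorus L A t U =
      magneticHubbardTorus L A t U * phaseGauge (fun _ : FermionTorus 2 L => c) := by
  have h := phaseGauge_mul_magneticHubbardTorus_mul_conjTranspose (L := L) (fun _ : TorusSite 2 L => c) A t U
  have hg : gaugeTransform (fun _ : TorusSite 2 L => c)⁻¹ A = A := by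
    funext e; simp only [gaugeTransform, Pi.inv_apply, inv_inv]
    rw [mul_comm c⁻¹ (A e), mul_assoc, inv_mul_cancel, mul_one]
  rw [hg] at h
  have h2 := congrArg (fun M => M * phaseGauge (fun _ : FermionTorus 2 L => c)) h
  simp only at h2
  rw [Matrix.mul_assoc, conjTranspose_phaseGauge_mul_self, Matrix.mul_one] at h2
  exact h2

end Torus

end Summit.Ventures.CertifiedManyBodySolver.Rows
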